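import Mathlib.LinearAlgebra.FiniteDimensional.Lemmas
import Mathlib.Algebra.Module.Submodule.Range
import HarnessLib

/-!
# The saturation / new-quotient bridge as a dimension count (cell `b2b-bsdres`, seat additive-p4 gen 36, line V62 — Proposition D3 (β))

HONEST FRAMING (verbatim, cell `b2b-bsdres`): the goal of the cell is to DELETE the COMBINATION-SHAPED
residual classes for ALL analytic-rank `≤ 1` curves over `ℚ` — "full BSD formula for every rank `≤ 1`
curve in class `C`" assembled STRICTLY from published theorems — so that the rank-`≤ 1` remainder
becomes exactly the CONSTRUCTION-SHAPED classes, which are TYPED (missing-input Props), NOT attempted;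
this is not "finishing BSD". This file: ONE TOOL theorem (linear algebra over a field; 0 defs, 0 facts,
nothing booked; X4 stays CONSTRUCTION-SHAPED; no mark moves).

## Why

Memo V62, Proposition D3 (β): at the semistable level `N' = pM`, reduce everything mod `p` at a
non-Eisenstein `𝔪`. Let `V` be the mod-`p` block, `O ≤ V` the (reduction of the saturated) sum of the
`ℓ₁`- and `ℓ₂`-old lattices, `U` the mod-`p` block of level `M` taken TWICE and `J : U → V` the pair of
`p`-degeneracy maps (injective mod `p`: Ihara's lemma at `p`), `P ≤ U` the old part of `U` (so `J(P) ≤ O`).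
Then THREE-PRIME SATURATION EX₃ ("`O_{ℓ₁} + O_{ℓ₂} + O_p` is saturated", measured by instrument E15 as
`Δ₃ = 0`) is the DIMENSION statement `dim(O ⊔ range J) = dim O + dim U − dim P`, and "Ihara at `p` for the
`{ℓ₁,ℓ₂}`-new quotients" INQ_p is the statement `J⁻¹(O) = P` (E15's column `INQp-defect = 0`). The theorem
below says these are the SAME statement — pure linear algebra (`dim(O ⊔ R) + dim(O ⊓ R) = dim O + dim R`,
`O ⊓ range J = J(J⁻¹O)`, and a subspace of `J⁻¹O` of the same dimension is all of it). It is the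
three-prime analogue of `X4/TwoPrimeExactnessBridges.lean` (`signedExact_of_newQuotient` /
`newQuotient_of_signedExact`), in the language in which the census instruments compute.

## References (context only; the proof is elementary)

* K. Ribet, Proc. ICM 1983 (1984), Thm. 4.1 (Ihara at one prime: `J` injective mod `p`). [cite: Ribet1984ICM, Thm. 4.1]
* A. Wiles, Ann. of Math. 141 (1995), §2 (Ihara at a prime dividing the level). [cite: Wiles1995, §2]
-/

namespace Summit.BirchSwinnertonDyer.Rank1Residual.LevelLowering

open Module Submodule

/-- **EX₃ ⟺ INQ_p as a dimension count (memo V62, Prop. D3 (β)).** `F` a field, `U, V` finite-dimensional,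
`J : U →ₗ V` injective (Ihara at `p` mod `p`), `O ≤ V` (the `{ℓ₁,ℓ₂}`-old subspace), `P ≤ U` with `J(P) ≤ O`
(the old part one level down). Then
`finrank (O ⊔ range J) + finrank P = finrank O + finrank U` (the three-prime sum has the "expected"
dimension: EX₃, instrument E15's `Δ₃ = 0`) **iff** `O.comap J = P` (an element of `U` whose image is
`{ℓ₁,ℓ₂}`-old is itself old: Ihara at `p` for the new quotients, E15's `INQp-defect = 0`).
[cite: Ribet1984ICM, Thm. 4.1] [cite: Wiles1995, §2] -/
theorem finrank_sup_range_add_eq_iff_comap_eq {F U V : Type*} [Field F] [AddCommGroup U] [Module F U]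
    [AddCommGroup V] [Module F V] [FiniteDimensional F U] [FiniteDimensional F V]
    (J : U →ₗ[F] V) (hJ : Function.Injective J) (O : Submodule F V) (P : Submodule F U)
    (hP : P.map J ≤ O) :
    finrank F ↥(O ⊔ LinearMap.range J) + finrank F P = finrank F O + finrank F U ↔ O.comap J = P := by
  -- the two standard identities
  have hsum := Submodule.finrank_sup_add_finrank_inf_eq O (LinearMap.range J)
  have hrange : finrank F ↥(LinearMap.range J) = finrank F U := LinearMap.finrank_range_of_inj hJ
  -- `O ⊓ range J = J (J⁻¹ O)`, of the same dimension as `J⁻¹ O`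
  have hinf : O ⊓ LinearMap.range J = (O.comap J).map J := by
    rw [Submodule.map_comap_eq, inf_comm]
  have hdim : finrank F ↥(O ⊓ LinearMap.range J) = finrank F ↥(O.comap J) := by
    rw [hinf]
    exact LinearEquiv.finrank_eq (Submodule.equivMapOfInjective J hJ (O.comap J)).symm
  have hle : P ≤ O.comap J := Submodule.map_le_iff_le_comap.mp hP
  constructor
  · intro h
    -- from the count, `finrank (O.comap J) = finrank P`; with `P ≤ O.comap J` they are equal
    have hPO : finrank F P = finrank F ↥(O.comap J) := by omega
    exact (Submodule.eq_of_le_of_finrank_eq hle hPO).symm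
  · intro h
    rw [← h]
    omega

end Summit.BirchSwinnertonDyer.Rank1Residual.LevelLowering
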